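import Literature.Probability.LatticeModels.RandomClusterFKG
import Literature.Probability.Percolation.SubgraphMonotonicity
import HarnessLib

/-!
# The wired domain Markov property of the random-cluster model and monotonicity in the domain

Topic `Literature/Probability/LatticeModels`. For the finite-graph random-cluster measure
`rcMeasure` of the tree (Grimmett 2006, (1.2); wired vertex sets, §4.2) we prove, for two nested
finite vertex sets `Λ ⊆ Δ` of a locally finite graph `G`, with `∂Λ`, `∂Δ` their inner vertex
boundaries wired (Grimmett's boundary condition `ξ = 1`, (4.11)–(4.12)):

1. **Cluster-count identity** (`clusterCount_openExtension`): if `ξ` is a configuration of `E_Λ`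
   and `ξ ∨ 1_{E_Δ∖E_Λ}` denotes its extension to `E_Δ` by opening every edge not inside `Λ`,
   then `k¹_Δ(ξ ∨ 1_{E_Δ∖E_Λ}) = k¹_Λ(ξ)` (clusters counted with `∂Δ`, resp. `∂Λ`, wired) — the
   inclusion `Λ → Δ` induces a bijection of clusters. Hypotheses: the "environment"
   `(Δ ∖ Λ) ∪ ∂Λ` is connected through the edges `E_Δ ∖ E_Λ` and the wiring of `∂Δ`
   (`box_envSet_connected` proves this for boxes of `ℤ^d`), and `∂Λ ≠ ∅` unless `Δ ∖ Λ = ∅`.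
2. **Wired domain Markov property** (`rcMeasure_real_restrict_inter_outerOpen`; Grimmett 2006,
   Lemma (4.13) with `ξ = 1`, "we apply Theorem 3.1(a) repeatedly, once for each edge in
   `E_Δ ∖ E_Λ`"): `φ¹_{Δ,p,q}(ρ⁻¹(B) ∩ U) = φ¹_{Δ,p,q}(U) · φ¹_{Λ,p,q}(B)` for every event `B` of
   `E_Λ`, where `U = {all edges of E_Δ ∖ E_Λ are open}` and `ρ` restricts a configuration of
   `E_Δ` to `E_Λ`; `0 ≤ p ≤ 1`, `q > 0`. Proof: reindex the configurations in `U` by their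
   restriction and use item 1 on the weights (`rcWeight_openExtensionFin`).
3. **Monotonicity in the domain** (`rcMeasure_real_restrict_le`; Grimmett 2006, proof of
   Thm. (4.19)(a), eq. (4.24) "for `b = 1` … we reverse the inequality"): for `0 ≤ p ≤ 1`,
   `q ≥ 1` and increasing `B`, `φ¹_{Δ,p,q}(ρ⁻¹ B) ≤ φ¹_{Λ,p,q}(B)`, from item 2 and positive
   association (the tree's proved FKG inequality `rcMeasure_fkg_holds`).
4. Two general lemmas: the measure lives on the edge sets of the graph
   (`rcMeasure_real_mono_on_edgeSets`), and an open path of `ω ⊆ E_Δ` from `x ∈ Λ` to `∂Δ`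
   yields a `ρ(ω)`-open path of `Λ` from `x` to `∂Λ` (`exists_reachable_wiredBoundary_restrict`,
   the event inclusion in the proof of Grimmett's Prop. (5.11)).
5. **Boxes of `ℤ^d`** (`Λ_m ⊆ Λ_n`, `m ≤ n`, `d ≥ 1`): the environment is connected (walk outwards
   along a coordinate axis to `∂Λ_n`, which is wired; `box_envSet_connected`), `∂Λ_m ≠ ∅`, hence
   items 2–3 hold unconditionally: `rcMeasure_real_box_restrict_inter_outerOpen`,
   `rcMeasure_real_box_restrict_le` (the wired box measures decrease as the box grows). The
   barrier companion file `Literature.Barriers.CriticalPhenomena.RandomClusterFirstOrderProofs`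
   uses this to show that `φ¹_{Λ_n,p,q}(0 ↔ ∂Λ_n)` is non-increasing in `n` and converges to
   `θ¹(p, q)` (Grimmett 2006, Prop. (5.11)).

## Design

* Vertex types are the coerced finsets `↥Λ`, graphs `finsetGraph G Λ = G.comap Subtype.val`
  with the evident decidable adjacency, wired sets `wiredBoundary G Λ = {x | x.1 ∈ ∂^{in}Λ}`;
  for `G = zdGraph d`, `Λ = box d n` these are *definitionally* the objects `boxGraph`,
  `boxBoundary` of `Literature.Barriers.CriticalPhenomena.RandomClusterFirstOrder`.
* Edges of `Λ` are moved to `Δ` by the embedding `edgeLift h = (inclusion).sym2Map` (Mathlib's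
  `Function.Embedding.sym2Map`); `insideEdges`/`outsideEdges` are `E_Λ` (lifted) and `E_Δ ∖ E_Λ`;
  `finsetRestrict h ω` is the pull-back of a configuration, an `abbrev` for the tree's
  `Literature.Probability.Percolation.restrictConfig (finsetIncl h)`.
* The bijection of clusters in item 1 is `SimpleGraph.ConnectedComponent.lift` of the inclusion
  (forward: open edges lift, wired pairs of `∂Λ` are joined through the environment) with
  injectivity by a "potential" on `Δ` that is constant along edges (`clusterPotential`).
* At `p = 0` the event `U` of item 3 is null and the conditioning argument does not apply; both
  measures are then the point mass at `∅` and the inequality is checked directly, so that item 3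
  is stated for the printed range `0 ≤ p ≤ 1`.

## What is not here

* The free boundary condition (`(4.24)` as printed, `b = 0`: conditioning on `E_Δ ∖ E_Λ` closed),
  general boundary conditions `ξ` (Lemma (4.13) in full), and infinite-volume limits
  (Thm. (4.19)): only the wired, finite-volume statements needed for `θ¹` are proved.

## References

* G. Grimmett, *The Random-Cluster Model*, Springer 2006: §1.2 (1.2); Thm. (3.1)(a); §4.2
  (4.11)–(4.13), Lemma (4.13), Lemma (4.14); Thm. (4.19)(a) and its proof, eq. (4.24);
  Prop. (5.11).
-/

noncomputable section

open MeasureTheory Finset SimpleGraph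

namespace Literature.Probability.LatticeModels

variable {V : Type*}

/-! ### Finite pieces of a graph, with their inner vertex boundary wired -/

/-- The graph `(Λ, E_Λ)`: the restriction of `G` to the finite vertex set `Λ` (edges of `G` with
both endpoints in `Λ`), on the vertex type `↥Λ`. For `G = ℤ^d` and `Λ` a box this is the graph of
Grimmett 2006, §4.2. [cite: Grimmett2006, §4.2 (E_Λ)] -/
abbrev finsetGraph (G : SimpleGraph V) (Λ : Finset V) : SimpleGraph Λ := G.comap Subtype.val

/-- Adjacency in `finsetGraph G Λ` is adjacency in `G` of the underlying vertices, hence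
decidable. [folklore] -/
instance instDecidableRelFinsetGraphAdj (G : SimpleGraph V) [DecidableRel G.Adj] (Λ : Finset V) :
    DecidableRel (finsetGraph G Λ).Adj :=
  fun x y => inferInstanceAs (Decidable (G.Adj x.1 y.1))

/-- The inner vertex boundary `∂Λ` of `Λ` (vertices of `Λ` with a `G`-neighbour outside `Λ`), as a
set of vertices of `finsetGraph G Λ`; wiring it gives Grimmett's wired boundary condition
`ξ = 1`. [cite: Grimmett2006, §4.2 (4.11)–(4.12), ξ = 1] -/
def wiredBoundary [DecidableEq V] (G : SimpleGraph V) [G.LocallyFinite] (Λ : Finset V) : Set Λ :=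
  {x | x.1 ∈ innerBoundary G Λ}

/-- Membership in `wiredBoundary`. [cite: Grimmett2006, §4.2] -/
@[simp] theorem mem_wiredBoundary_iff [DecidableEq V] {G : SimpleGraph V} [G.LocallyFinite]
    {Λ : Finset V} (x : Λ) : x ∈ wiredBoundary G Λ ↔ x.1 ∈ innerBoundary G Λ := Iff.rfl

/-- Adjacency in the restricted graph. [folklore] -/
theorem finsetGraph_adj_iff {G : SimpleGraph V} {Λ : Finset V} (x y : Λ) :
    (finsetGraph G Λ).Adj x y ↔ G.Adj x.1 y.1 := Iff.rfl

/-! ### Two nested finite vertex sets `Λ ⊆ Δ` -/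

/-- The inclusion of vertex types `↥Λ → ↥Δ` for finite vertex sets `Λ ⊆ Δ`. [folklore] -/
def finsetIncl {Λ Δ : Finset V} (h : Λ ⊆ Δ) (x : Λ) : Δ := ⟨x.1, h x.2⟩

/-- The inclusion does not change the underlying vertex. [folklore] -/
@[simp] theorem finsetIncl_coe {Λ Δ : Finset V} (h : Λ ⊆ Δ) (x : Λ) : (finsetIncl h x : V) = x := rfl

/-- The inclusion is injective. [folklore] -/
theorem finsetIncl_injective {Λ Δ : Finset V} (h : Λ ⊆ Δ) : Function.Injective (finsetIncl h) :=
  fun x y hxy => Subtype.ext (by simpa [finsetIncl] using congrArg Subtype.val hxy)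

/-- The inclusion `↥Λ ↪ ↥Δ` as an embedding. [folklore] -/
def finsetInclEmb {Λ Δ : Finset V} (h : Λ ⊆ Δ) : Λ ↪ Δ := ⟨finsetIncl h, finsetIncl_injective h⟩

/-- The induced embedding of edges (unordered pairs) `Sym2 ↥Λ ↪ Sym2 ↥Δ`: Mathlib's
`Function.Embedding.sym2Map` of the inclusion. [folklore] -/
abbrev edgeLift {Λ Δ : Finset V} (h : Λ ⊆ Δ) : Sym2 Λ ↪ Sym2 Δ := (finsetInclEmb h).sym2Map

/-- `edgeLift` on a pair. [folklore] -/
@[simp] theorem edgeLift_mk {Λ Δ : Finset V} (h : Λ ⊆ Δ) (a b : Λ) :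
    edgeLift h s(a, b) = s(finsetIncl h a, finsetIncl h b) := Sym2.map_mk _ _ _

/-- Adjacency is reflected and preserved by the inclusion. [folklore] -/
theorem adj_finsetIncl_iff {G : SimpleGraph V} {Λ Δ : Finset V} (h : Λ ⊆ Δ) (x y : Λ) :
    (finsetGraph G Δ).Adj (finsetIncl h x) (finsetIncl h y) ↔ (finsetGraph G Λ).Adj x y := Iff.rfl

/-- Restriction of a bond configuration of `Δ` to the edges of `Λ ⊆ Δ` (pull back along
`edgeLift`): the tree's `Literature.Probability.Percolation.restrictConfig` along the inclusion
`finsetIncl h` (an `abbrev`, so that both APIs apply). [cite: Grimmett2006, §4.2 (configurations on E_Λ)] -/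
abbrev finsetRestrict {Λ Δ : Finset V} (h : Λ ⊆ Δ) (ω : Percolation.BondConfig Δ) :
    Percolation.BondConfig Λ :=
  Percolation.restrictConfig (finsetIncl h) ω

/-- Membership in the restricted configuration. [folklore] -/
@[simp] theorem mem_finsetRestrict_iff {Λ Δ : Finset V} (h : Λ ⊆ Δ) (ω : Percolation.BondConfig Δ)
    (e : Sym2 Λ) : e ∈ finsetRestrict h ω ↔ edgeLift h e ∈ ω := Iff.rfl

/-- The restriction of the empty configuration is empty. [folklore] -/
@[simp] theorem finsetRestrict_empty {Λ Δ : Finset V} (h : Λ ⊆ Δ) :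
    finsetRestrict h (∅ : Percolation.BondConfig Δ) = ∅ := rfl

/-- Restriction is monotone. [folklore] -/
theorem finsetRestrict_mono {Λ Δ : Finset V} (h : Λ ⊆ Δ) : Monotone (finsetRestrict h) :=
  fun _ _ hω _ he => hω he

/-- The edges of `Δ` inside `Λ`: the image of `E_Λ` under `edgeLift`. [cite: Grimmett2006, §4.2 (E_Λ)] -/
def insideEdges (G : SimpleGraph V) [DecidableRel G.Adj] {Λ Δ : Finset V} (h : Λ ⊆ Δ) :
    Finset (Sym2 Δ) :=
  (finsetGraph G Λ).edgeFinset.map (edgeLift h)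

/-- The edges of `Δ` not inside `Λ`: `E_Δ ∖ E_Λ` (at least one endpoint outside `Λ`).
[cite: Grimmett2006, proof of Thm. (4.19)(a) (the edges E_Δ ∖ E_Λ)] -/
def outsideEdges [DecidableEq V] (G : SimpleGraph V) [DecidableRel G.Adj] {Λ Δ : Finset V} (h : Λ ⊆ Δ) :
    Finset (Sym2 Δ) :=
  (finsetGraph G Δ).edgeFinset \ insideEdges G h

/-- The vertices of `Δ` outside `Λ` together with the inner boundary of `Λ`: the vertices that the
event "all edges of `E_Δ ∖ E_Λ` are open" merges with the wired boundary cluster. [folklore] -/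
def envSet [DecidableEq V] (G : SimpleGraph V) [G.LocallyFinite] (Λ Δ : Finset V) : Set Δ :=
  {v | v.1 ∉ Λ ∨ v.1 ∈ innerBoundary G Λ}

/-- The "environment graph" on `Δ`: the edges `E_Δ ∖ E_Λ` together with the wiring of `∂Δ`.
[folklore] -/
def envGraph [DecidableEq V] (G : SimpleGraph V) [DecidableRel G.Adj] [G.LocallyFinite]
    {Λ Δ : Finset V} (h : Λ ⊆ Δ) : SimpleGraph Δ :=
  fromEdgeSet (↑(outsideEdges G h) : Set (Sym2 Δ)) ⊔ wired (wiredBoundary G Δ)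

section Edges

variable {G : SimpleGraph V} [DecidableRel G.Adj] {Λ Δ : Finset V} (h : Λ ⊆ Δ)

/-- `E_Λ ⊆ E_Δ` after lifting. [folklore] -/
theorem insideEdges_subset_edgeFinset : insideEdges G h ⊆ (finsetGraph G Δ).edgeFinset := by
  intro e he
  obtain ⟨e', he', rfl⟩ := Finset.mem_map.1 he
  induction e' using Sym2.ind with
  | h a b =>
    rw [mem_edgeFinset, mem_edgeSet] at he'
    rw [edgeLift_mk, mem_edgeFinset, mem_edgeSet]
    exact he'

/-- A lifted pair is an edge of `Δ` iff it is an edge of `Λ`. [folklore] -/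
theorem edgeLift_mem_edgeFinset_iff (e : Sym2 Λ) :
    edgeLift h e ∈ (finsetGraph G Δ).edgeFinset ↔ e ∈ (finsetGraph G Λ).edgeFinset := by
  induction e using Sym2.ind with
  | h a b => rw [edgeLift_mk, mem_edgeFinset, mem_edgeSet, mem_edgeFinset, mem_edgeSet]; rfl

/-- A lifted pair is an inner edge iff it is an edge of `Λ`. [folklore] -/
theorem edgeLift_mem_insideEdges_iff (e : Sym2 Λ) :
    edgeLift h e ∈ insideEdges G h ↔ e ∈ (finsetGraph G Λ).edgeFinset := by
  rw [insideEdges, Finset.mem_map' (edgeLift h)]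

end Edges

section OuterEdges

variable [DecidableEq V] {G : SimpleGraph V} [DecidableRel G.Adj] {Λ Δ : Finset V} (h : Λ ⊆ Δ)

/-- A lifted pair is never an outer edge. [folklore] -/
theorem edgeLift_notMem_outsideEdges (e : Sym2 Λ) : edgeLift h e ∉ outsideEdges G h := by
  rw [outsideEdges, Finset.mem_sdiff, edgeLift_mem_insideEdges_iff, edgeLift_mem_edgeFinset_iff]
  exact fun h' => h'.2 h'.1

/-- Inner and outer edges are disjoint. [folklore] -/
theorem disjoint_insideEdges_outsideEdges : Disjoint (insideEdges G h) (outsideEdges G h) :=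
  Finset.disjoint_sdiff

/-- `E_Δ = E_Λ ∪ (E_Δ ∖ E_Λ)`. [folklore] -/
theorem insideEdges_union_outsideEdges :
    insideEdges G h ∪ outsideEdges G h = (finsetGraph G Δ).edgeFinset :=
  Finset.union_sdiff_of_subset (insideEdges_subset_edgeFinset h)

/-- `E_Δ ∖ (E_Δ ∖ E_Λ) = E_Λ`. [folklore] -/
theorem edgeFinset_sdiff_outsideEdges :
    (finsetGraph G Δ).edgeFinset \ outsideEdges G h = insideEdges G h :=
  Finset.sdiff_sdiff_eq_self (insideEdges_subset_edgeFinset h)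

/-- Outer edges are edges of `Δ`. [folklore] -/
theorem outsideEdges_subset_edgeFinset : outsideEdges G h ⊆ (finsetGraph G Δ).edgeFinset :=
  Finset.sdiff_subset

end OuterEdges

section Env

variable [DecidableEq V] {G : SimpleGraph V} [DecidableRel G.Adj] [G.LocallyFinite] {Λ Δ : Finset V}

omit [DecidableRel G.Adj] in
/-- The vertices of `∂Δ` lie in the environment set. [folklore] -/
theorem wiredBoundary_subset_envSet (h : Λ ⊆ Δ) : wiredBoundary G Δ ⊆ envSet G Λ Δ := by
  intro v hv
  rw [mem_wiredBoundary_iff, mem_innerBoundary_iff] at hv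
  obtain ⟨_, y, hy, hvy⟩ := hv
  by_cases hvΛ : v.1 ∈ Λ
  · exact Or.inr (mem_innerBoundary_iff.2 ⟨hvΛ, y, fun hyΛ => hy (h hyΛ), hvy⟩)
  · exact Or.inl hvΛ

/-- An edge of `E_Δ ∖ E_Λ` has both endpoints in the environment set (an endpoint inside `Λ` has
its other endpoint outside `Λ`, so it lies on `∂Λ`). [folklore] -/
theorem mem_envSet_of_mem_outsideEdges (h : Λ ⊆ Δ) {u v : Δ} (he : s(u, v) ∈ outsideEdges G h) :
    u ∈ envSet G Λ Δ ∧ v ∈ envSet G Λ Δ := by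
  rw [outsideEdges, Finset.mem_sdiff, mem_edgeFinset, mem_edgeSet] at he
  obtain ⟨hadj, hnot⟩ := he
  have hadj' : G.Adj u.1 v.1 := hadj
  have key : ¬(u.1 ∈ Λ ∧ v.1 ∈ Λ) := by
    rintro ⟨hu, hv⟩
    apply hnot
    have : s(u, v) = edgeLift h s(⟨u.1, hu⟩, ⟨v.1, hv⟩) := by rw [edgeLift_mk]; rfl
    rw [this, edgeLift_mem_insideEdges_iff, mem_edgeFinset, mem_edgeSet]
    exact hadj'
  constructor
  · by_cases hu : u.1 ∈ Λ
    · exact Or.inr (mem_innerBoundary_iff.2 ⟨hu, v.1, fun hv => key ⟨hu, hv⟩, hadj'⟩)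
    · exact Or.inl hu
  · by_cases hv : v.1 ∈ Λ
    · exact Or.inr (mem_innerBoundary_iff.2 ⟨hv, u.1, fun hu => key ⟨hu, hv⟩, hadj'.symm⟩)
    · exact Or.inl hv

omit [DecidableRel G.Adj] in
/-- A vertex of `Λ` lies in the environment set iff it is on `∂Λ`. [folklore] -/
theorem finsetIncl_mem_envSet_iff (h : Λ ⊆ Δ) (a : Λ) :
    finsetIncl h a ∈ envSet G Λ Δ ↔ a.1 ∈ innerBoundary G Λ := by
  simp only [envSet, Set.mem_setOf_eq, finsetIncl_coe]
  exact ⟨fun h' => h'.resolve_left (fun hn => hn a.2), Or.inr⟩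

end Env


/-! ### The cluster-count identity: opening `E_Δ ∖ E_Λ` and wiring `∂Δ` acts on `E_Λ` as wiring `∂Λ` -/

section ClusterCount

variable [DecidableEq V] {G : SimpleGraph V} [DecidableRel G.Adj] [G.LocallyFinite] {Λ Δ : Finset V}

/-- The configuration of `Δ` obtained from a configuration `ξ` of `Λ` by declaring every edge of
`E_Δ ∖ E_Λ` open (the configurations of the event "all edges off `E_Λ` are open", indexed by
their restriction to `E_Λ`). [cite: Grimmett2006, proof of Thm. (4.19)(a)] -/
def openExtension (G : SimpleGraph V) [DecidableRel G.Adj] (h : Λ ⊆ Δ)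
    (ξ : Percolation.BondConfig Λ) : Percolation.BondConfig Δ :=
  edgeLift h '' ξ ∪ ↑(outsideEdges G h)

variable (h : Λ ⊆ Δ)

/-- The open graph of the extended configuration, with `∂Δ` wired, contains the environment
graph. [folklore] -/
theorem envGraph_le_openGraph_openExtension (ξ : Percolation.BondConfig Λ) :
    envGraph G h ≤ Percolation.openGraph (openExtension G h ξ) ⊔ wired (wiredBoundary G Δ) :=
  sup_le_sup_right (fromEdgeSet_mono Set.subset_union_right) _

/-- Forward direction, one step: an edge of the wired open graph of `ξ` on `Λ` joins vertices
whose images are joined in the wired open graph of the extension (an open edge lifts to an open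
edge; two vertices of `∂Λ` are joined through the environment). [folklore] -/
theorem reachable_openExtension_of_adj
    (hW : ∀ u ∈ envSet G Λ Δ, ∀ v ∈ envSet G Λ Δ, (envGraph G h).Reachable u v)
    (ξ : Percolation.BondConfig Λ) {a b : Λ}
    (hab : (Percolation.openGraph ξ ⊔ wired (wiredBoundary G Λ)).Adj a b) :
    (Percolation.openGraph (openExtension G h ξ) ⊔ wired (wiredBoundary G Δ)).Reachable
      (finsetIncl h a) (finsetIncl h b) := by
  rw [sup_adj, Percolation.openGraph, fromEdgeSet_adj, wired_adj] at hab
  rcases hab with ⟨he, hne⟩ | ⟨_, ha, hb⟩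
  · refine Adj.reachable ?_
    rw [sup_adj, Percolation.openGraph, fromEdgeSet_adj]
    refine Or.inl ⟨Or.inl ⟨s(a, b), he, (edgeLift_mk h a b)⟩, ?_⟩
    exact fun h' => hne (finsetIncl_injective h h')
  · exact (hW _ ((finsetIncl_mem_envSet_iff h a).2 ha) _ ((finsetIncl_mem_envSet_iff h b).2 hb)).mono
      (envGraph_le_openGraph_openExtension h ξ)

/-- Forward direction: vertices joined in the wired open graph of `ξ` on `Λ` have images joined in
the wired open graph of the extension. [folklore] -/
theorem reachable_openExtension_of_reachable
    (hW : ∀ u ∈ envSet G Λ Δ, ∀ v ∈ envSet G Λ Δ, (envGraph G h).Reachable u v)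
    (ξ : Percolation.BondConfig Λ) {a b : Λ}
    (hab : (Percolation.openGraph ξ ⊔ wired (wiredBoundary G Λ)).Reachable a b) :
    (Percolation.openGraph (openExtension G h ξ) ⊔ wired (wiredBoundary G Δ)).Reachable
      (finsetIncl h a) (finsetIncl h b) := by
  obtain ⟨p⟩ := hab
  induction p with
  | nil => exact Reachable.refl _
  | cons hadj _ ih => exact (reachable_openExtension_of_adj h hW ξ hadj).trans ih

/-- A "potential" on the vertices of `Δ` with values in the clusters of `ξ` on `Λ` (wired at
`∂Λ`): a vertex of `Λ` is sent to its cluster, a vertex outside `Λ` to the boundary cluster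
(or to a default value `c` if `∂Λ = ∅`). [folklore] -/
def clusterPotential (ξ : Percolation.BondConfig Λ)
    (c : (Percolation.openGraph ξ ⊔ wired (wiredBoundary G Λ)).ConnectedComponent) (v : Δ) :
    (Percolation.openGraph ξ ⊔ wired (wiredBoundary G Λ)).ConnectedComponent :=
  if hv : v.1 ∈ Λ then (Percolation.openGraph ξ ⊔ wired (wiredBoundary G Λ)).connectedComponentMk ⟨v.1, hv⟩
  else if hb : (innerBoundary G Λ).Nonempty then
    (Percolation.openGraph ξ ⊔ wired (wiredBoundary G Λ)).connectedComponentMk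
      ⟨hb.choose, (mem_innerBoundary_iff.1 hb.choose_spec).1⟩
  else c

omit [DecidableRel G.Adj] in
/-- The potential of (the image of) a vertex of `Λ` is its cluster. [folklore] -/
theorem clusterPotential_finsetIncl (ξ : Percolation.BondConfig Λ)
    (c : (Percolation.openGraph ξ ⊔ wired (wiredBoundary G Λ)).ConnectedComponent) (a : Λ) :
    clusterPotential ξ c (finsetIncl h a) =
      (Percolation.openGraph ξ ⊔ wired (wiredBoundary G Λ)).connectedComponentMk a := by
  simp only [clusterPotential, finsetIncl_coe, Finset.coe_mem, ↓reduceDIte]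

omit [DecidableRel G.Adj] in
/-- Two vertices of `∂Λ` have the same cluster (they are wired). [folklore] -/
theorem connectedComponentMk_eq_of_mem_innerBoundary (ξ : Percolation.BondConfig Λ) {a b : Λ}
    (ha : a.1 ∈ innerBoundary G Λ) (hb : b.1 ∈ innerBoundary G Λ) :
    (Percolation.openGraph ξ ⊔ wired (wiredBoundary G Λ)).connectedComponentMk a =
      (Percolation.openGraph ξ ⊔ wired (wiredBoundary G Λ)).connectedComponentMk b := by
  rw [ConnectedComponent.eq]
  by_cases hab : a = b
  · rw [hab]
  · refine Adj.reachable ?_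
    rw [sup_adj, wired_adj]
    exact Or.inr ⟨hab, ha, hb⟩

omit [DecidableRel G.Adj] in
/-- The potential is constant on the environment set (equal to the boundary cluster).
[folklore] -/
theorem clusterPotential_eq_of_mem_envSet (ξ : Percolation.BondConfig Λ)
    (c : (Percolation.openGraph ξ ⊔ wired (wiredBoundary G Λ)).ConnectedComponent)
    (hW' : (∃ v : Δ, v.1 ∉ Λ) → (innerBoundary G Λ).Nonempty) {u v : Δ}
    (hu : u ∈ envSet G Λ Δ) (hv : v ∈ envSet G Λ Δ) :
    clusterPotential ξ c u = clusterPotential ξ c v := by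
  -- both values are the cluster of the chosen boundary vertex
  have key : ∀ w : Δ, w ∈ envSet G Λ Δ → ∃ hb : (innerBoundary G Λ).Nonempty,
      clusterPotential ξ c w =
        (Percolation.openGraph ξ ⊔ wired (wiredBoundary G Λ)).connectedComponentMk
          ⟨hb.choose, (mem_innerBoundary_iff.1 hb.choose_spec).1⟩ := by
    intro w hw
    by_cases hwΛ : w.1 ∈ Λ
    · have hwb : w.1 ∈ innerBoundary G Λ := hw.resolve_left (fun hn => hn hwΛ)
      refine ⟨⟨w.1, hwb⟩, ?_⟩
      simp only [clusterPotential, hwΛ, ↓reduceDIte]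
      exact connectedComponentMk_eq_of_mem_innerBoundary ξ hwb (Exists.choose_spec _)
    · have hb : (innerBoundary G Λ).Nonempty := hW' ⟨w, hwΛ⟩
      refine ⟨hb, ?_⟩
      simp only [clusterPotential, hwΛ, hb, ↓reduceDIte]
  obtain ⟨_, hu'⟩ := key u hu
  obtain ⟨_, hv'⟩ := key v hv
  rw [hu', hv']

/-- The potential is constant along the edges of the wired open graph of the extension.
[folklore] -/
theorem clusterPotential_eq_of_adj (ξ : Percolation.BondConfig Λ)
    (c : (Percolation.openGraph ξ ⊔ wired (wiredBoundary G Λ)).ConnectedComponent)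
    (hW' : (∃ v : Δ, v.1 ∉ Λ) → (innerBoundary G Λ).Nonempty) {u v : Δ}
    (huv : (Percolation.openGraph (openExtension G h ξ) ⊔ wired (wiredBoundary G Δ)).Adj u v) :
    clusterPotential ξ c u = clusterPotential ξ c v := by
  rw [sup_adj, Percolation.openGraph, fromEdgeSet_adj, wired_adj, openExtension, Set.mem_union,
    Finset.mem_coe] at huv
  rcases huv with ⟨hmem | hout, _⟩ | ⟨_, hu, hv⟩
  · -- an open edge of `Λ`
    obtain ⟨e, he, heuv⟩ := hmem
    induction e using Sym2.ind with
    | h a b =>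
      rw [edgeLift_mk, Sym2.eq_iff] at heuv
      have hab : (Percolation.openGraph ξ ⊔ wired (wiredBoundary G Λ)).connectedComponentMk a =
          (Percolation.openGraph ξ ⊔ wired (wiredBoundary G Λ)).connectedComponentMk b := by
        rw [ConnectedComponent.eq]
        by_cases hab : a = b
        · rw [hab]
        · refine Adj.reachable ?_
          rw [sup_adj, Percolation.openGraph, fromEdgeSet_adj]
          exact Or.inl ⟨he, hab⟩
      rcases heuv with ⟨rfl, rfl⟩ | ⟨rfl, rfl⟩
      · rw [clusterPotential_finsetIncl, clusterPotential_finsetIncl, hab]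
      · rw [clusterPotential_finsetIncl, clusterPotential_finsetIncl, hab]
  · -- an outer edge: both endpoints in the environment
    obtain ⟨hu, hv⟩ := mem_envSet_of_mem_outsideEdges h hout
    exact clusterPotential_eq_of_mem_envSet ξ c hW' hu hv
  · -- a wired pair of `∂Δ`
    exact clusterPotential_eq_of_mem_envSet ξ c hW' (wiredBoundary_subset_envSet h hu)
      (wiredBoundary_subset_envSet h hv)

/-- Backward direction: if the images of two vertices of `Λ` are joined in the wired open graph of
the extension, the vertices are joined in the wired open graph of `ξ` on `Λ` (the potential is
constant along walks). [folklore] -/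
theorem reachable_of_reachable_openExtension (ξ : Percolation.BondConfig Λ)
    (hW' : (∃ v : Δ, v.1 ∉ Λ) → (innerBoundary G Λ).Nonempty) {a b : Λ}
    (hab : (Percolation.openGraph (openExtension G h ξ) ⊔ wired (wiredBoundary G Δ)).Reachable
      (finsetIncl h a) (finsetIncl h b)) :
    (Percolation.openGraph ξ ⊔ wired (wiredBoundary G Λ)).Reachable a b := by
  set c := (Percolation.openGraph ξ ⊔ wired (wiredBoundary G Λ)).connectedComponentMk a
  have key : ∀ u v : Δ,
      (Percolation.openGraph (openExtension G h ξ) ⊔ wired (wiredBoundary G Δ)).Reachable u v →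
        clusterPotential ξ c u = clusterPotential ξ c v := by
    intro u v huv
    obtain ⟨p⟩ := huv
    induction p with
    | nil => rfl
    | cons hadj _ ih => exact (clusterPotential_eq_of_adj h ξ c hW' hadj).trans ih
  have := key _ _ hab
  rwa [clusterPotential_finsetIncl, clusterPotential_finsetIncl, ConnectedComponent.eq] at this

/-- **The cluster-count identity.** If every two environment vertices are joined in the
environment graph (through `E_Δ ∖ E_Λ` and the wiring of `∂Δ`) and `∂Λ ≠ ∅` unless `Δ = Λ`, then
for every configuration `ξ` of `E_Λ` the number of clusters of the extension of `ξ` by the open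
edges `E_Δ ∖ E_Λ`, counted with `∂Δ` wired, equals the number of clusters of `ξ` counted with `∂Λ`
wired: `k¹_Δ(ξ ∨ 1_{E_Δ∖E_Λ}) = k¹_Λ(ξ)` (the combinatorial content of "conditioning `φ¹_Δ` on all
edges of `E_Δ ∖ E_Λ` being open gives `φ¹_Λ`"). [cite: Grimmett2006, Lemma (4.13) and proof of Thm. (4.19)(a)] -/
theorem clusterCount_openExtension
    (hW : ∀ u ∈ envSet G Λ Δ, ∀ v ∈ envSet G Λ Δ, (envGraph G h).Reachable u v)
    (hW' : (∃ v : Δ, v.1 ∉ Λ) → (innerBoundary G Λ).Nonempty) (ξ : Percolation.BondConfig Λ) :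
    clusterCount (openExtension G h ξ) (wiredBoundary G Δ) = clusterCount ξ (wiredBoundary G Λ) := by
  unfold clusterCount
  set G₁ := Percolation.openGraph (openExtension G h ξ) ⊔ wired (wiredBoundary G Δ)
  set G₂ := Percolation.openGraph ξ ⊔ wired (wiredBoundary G Λ)
  -- the map on clusters induced by the inclusion
  set Φ : G₂.ConnectedComponent → G₁.ConnectedComponent :=
    ConnectedComponent.lift (fun a => G₁.connectedComponentMk (finsetIncl h a))
      (fun a b p _ => ConnectedComponent.sound
        (reachable_openExtension_of_reachable h hW ξ p.reachable)) with hΦ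
  have hΦmk : ∀ a, Φ (G₂.connectedComponentMk a) = G₁.connectedComponentMk (finsetIncl h a) :=
    fun a => ConnectedComponent.lift_mk
  symm
  refine Nat.card_congr (Equiv.ofBijective Φ ⟨?_, ?_⟩)
  · -- injective
    intro C C' hCC'
    induction C using ConnectedComponent.ind with
    | h a =>
      induction C' using ConnectedComponent.ind with
      | h b =>
        rw [hΦmk, hΦmk, ConnectedComponent.eq] at hCC'
        exact ConnectedComponent.sound (reachable_of_reachable_openExtension h ξ hW' hCC')
  · -- surjective
    intro C
    induction C using ConnectedComponent.ind with
    | h v =>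
      by_cases hv : v.1 ∈ Λ
      · refine ⟨G₂.connectedComponentMk ⟨v.1, hv⟩, ?_⟩
        rw [hΦmk]
        rfl
      · obtain ⟨x, hx⟩ := hW' ⟨v, hv⟩
        set a : Λ := ⟨x, (mem_innerBoundary_iff.1 hx).1⟩
        refine ⟨G₂.connectedComponentMk a, ?_⟩
        rw [hΦmk, ConnectedComponent.eq]
        exact ((hW _ ((finsetIncl_mem_envSet_iff h a).2 hx) _ (Or.inl hv)).mono
          (envGraph_le_openGraph_openExtension h ξ))

end ClusterCount

/-! ### Finset bookkeeping: configurations of `E_Δ` containing `E_Δ ∖ E_Λ` ↔ configurations of `E_Λ` -/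

section Reindex

variable [DecidableEq V] {G : SimpleGraph V} [DecidableRel G.Adj] {Λ Δ : Finset V} (h : Λ ⊆ Δ)

/-- Finset version of `openExtension`: `ξ ↦ ξ ∪ (E_Δ ∖ E_Λ)` on finite edge sets. [folklore] -/
def openExtensionFin (G : SimpleGraph V) [DecidableRel G.Adj] (h : Λ ⊆ Δ) (ξ : Finset (Sym2 Λ)) :
    Finset (Sym2 Δ) :=
  ξ.map (edgeLift h) ∪ outsideEdges G h

/-- `openExtensionFin` is `openExtension` on coercions. [folklore] -/
theorem coe_openExtensionFin (ξ : Finset (Sym2 Λ)) :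
    (↑(openExtensionFin G h ξ) : Set (Sym2 Δ)) = openExtension G h ↑ξ := by
  rw [openExtensionFin, Finset.coe_union, Finset.coe_map, openExtension]

/-- The lifted part and the outer part of an extension are disjoint. [folklore] -/
theorem disjoint_map_outsideEdges (ξ : Finset (Sym2 Λ)) : Disjoint (ξ.map (edgeLift h)) (outsideEdges G h) := by
  rw [Finset.disjoint_left]
  intro e he
  obtain ⟨e', _, rfl⟩ := Finset.mem_map.1 he
  exact edgeLift_notMem_outsideEdges h e'

/-- Removing the outer edges from an extension recovers the lifted configuration. [folklore] -/
theorem openExtensionFin_sdiff_outsideEdges (ξ : Finset (Sym2 Λ)) :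
    openExtensionFin G h ξ \ outsideEdges G h = ξ.map (edgeLift h) := by
  rw [openExtensionFin, Finset.union_sdiff_cancel_right (disjoint_map_outsideEdges h ξ)]

/-- `openExtensionFin` is injective. [folklore] -/
theorem openExtensionFin_injective : Function.Injective (openExtensionFin G h) := by
  intro ξ ξ' hξ
  have := congrArg (· \ outsideEdges G h) hξ
  simp only [openExtensionFin_sdiff_outsideEdges] at this
  exact Finset.map_injective _ this

/-- An extension of a subset of `E_Λ` is a subset of `E_Δ`. [folklore] -/
theorem openExtensionFin_subset {ξ : Finset (Sym2 Λ)} (hξ : ξ ⊆ (finsetGraph G Λ).edgeFinset) :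
    openExtensionFin G h ξ ⊆ (finsetGraph G Δ).edgeFinset :=
  Finset.union_subset ((Finset.map_subset_map.2 hξ).trans (insideEdges_subset_edgeFinset h))
    (outsideEdges_subset_edgeFinset h)

/-- An extension contains the outer edges. [folklore] -/
theorem outsideEdges_subset_openExtensionFin (ξ : Finset (Sym2 Λ)) :
    outsideEdges G h ⊆ openExtensionFin G h ξ :=
  Finset.subset_union_right

/-- Restricting an extension to `E_Λ` recovers the configuration. [folklore] -/
theorem finsetRestrict_openExtension (ξ : Finset (Sym2 Λ)) :
    finsetRestrict h (↑(openExtensionFin G h ξ) : Set (Sym2 Δ)) = ↑ξ := by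
  ext e
  rw [mem_finsetRestrict_iff, Finset.mem_coe, Finset.mem_coe, openExtensionFin, Finset.mem_union,
    Finset.mem_map' (edgeLift h)]
  exact ⟨fun h' => h'.resolve_right (edgeLift_notMem_outsideEdges h e), Or.inl⟩

/-- The configurations of `E_Δ` containing all of `E_Δ ∖ E_Λ` are exactly the extensions of the
configurations of `E_Λ`. [folklore] -/
theorem filter_outsideEdges_subset_eq_map :
    (finsetGraph G Δ).edgeFinset.powerset.filter (fun ω => outsideEdges G h ⊆ ω) =
      (finsetGraph G Λ).edgeFinset.powerset.map ⟨openExtensionFin G h, openExtensionFin_injective h⟩ := by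
  ext ω
  simp only [Finset.mem_filter, Finset.mem_powerset, Finset.mem_map, Function.Embedding.coeFn_mk]
  constructor
  · rintro ⟨hω, hout⟩
    refine ⟨(finsetGraph G Λ).edgeFinset.filter (fun e => edgeLift h e ∈ ω), Finset.filter_subset _ _, ?_⟩
    ext e
    simp only [openExtensionFin, Finset.mem_union, Finset.mem_map, Finset.mem_filter]
    constructor
    · rintro (⟨e', ⟨_, he'⟩, rfl⟩ | he)
      · exact he'
      · exact hout he
    · intro he
      by_cases hout' : e ∈ outsideEdges G h
      · exact Or.inr hout'
      · have hin : e ∈ insideEdges G h := by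
          rw [← edgeFinset_sdiff_outsideEdges h, Finset.mem_sdiff]
          exact ⟨hω he, hout'⟩
        obtain ⟨e', he', rfl⟩ := Finset.mem_map.1 hin
        exact Or.inl ⟨e', ⟨he', he⟩, rfl⟩
  · rintro ⟨ξ, hξ, rfl⟩
    exact ⟨openExtensionFin_subset h hξ, outsideEdges_subset_openExtensionFin h ξ⟩

/-- The number of edges of an extension. [folklore] -/
theorem card_openExtensionFin (ξ : Finset (Sym2 Λ)) :
    #(openExtensionFin G h ξ) = #ξ + #(outsideEdges G h) := by
  rw [openExtensionFin, Finset.card_union_of_disjoint (disjoint_map_outsideEdges h ξ), Finset.card_map]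

/-- The number of closed edges of an extension of `ξ ⊆ E_Λ` is the number of closed edges of `ξ`.
[folklore] -/
theorem card_edgeFinset_sdiff_openExtensionFin (ξ : Finset (Sym2 Λ)) :
    #((finsetGraph G Δ).edgeFinset \ openExtensionFin G h ξ) = #((finsetGraph G Λ).edgeFinset \ ξ) := by
  have : (finsetGraph G Δ).edgeFinset \ openExtensionFin G h ξ =
      ((finsetGraph G Λ).edgeFinset \ ξ).map (edgeLift h) := by
    ext e
    simp only [openExtensionFin, Finset.mem_sdiff, Finset.mem_union, Finset.mem_map, not_or,
      not_exists, not_and]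
    constructor
    · rintro ⟨he, hmap, hout⟩
      have hin : e ∈ insideEdges G h := by
        rw [← edgeFinset_sdiff_outsideEdges h, Finset.mem_sdiff]
        exact ⟨he, hout⟩
      obtain ⟨e', he', rfl⟩ := Finset.mem_map.1 hin
      exact ⟨e', ⟨he', fun hξ => hmap e' hξ rfl⟩, rfl⟩
    · rintro ⟨e', ⟨he', hξ⟩, rfl⟩
      refine ⟨(edgeLift_mem_edgeFinset_iff h e').2 he', fun x hx hxe => ?_, edgeLift_notMem_outsideEdges h e'⟩
      exact hξ ((edgeLift h).injective hxe ▸ hx)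
  rw [this, Finset.card_map]

end Reindex

/-! ### The wired domain Markov property and monotonicity in the domain -/

section Measure

variable [DecidableEq V] {G : SimpleGraph V} [DecidableRel G.Adj] [G.LocallyFinite] {Λ Δ : Finset V}
  (h : Λ ⊆ Δ)

/-- The weight of an extension: `w_Δ(ξ ∪ (E_Δ ∖ E_Λ)) = p^{|E_Δ ∖ E_Λ|} w_Λ(ξ)` for `ξ ⊆ E_Λ`
(wired counts on both sides), by the cluster-count identity. [cite: Grimmett2006, Lemma (4.13) and proof of Thm. (4.19)(a)] -/
theorem rcWeight_openExtensionFin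
    (hW : ∀ u ∈ envSet G Λ Δ, ∀ v ∈ envSet G Λ Δ, (envGraph G h).Reachable u v)
    (hW' : (∃ v : Δ, v.1 ∉ Λ) → (innerBoundary G Λ).Nonempty) (p q : ℝ) (ξ : Finset (Sym2 Λ)) :
    rcWeight (finsetGraph G Δ) p q (wiredBoundary G Δ) (openExtensionFin G h ξ) =
      p ^ #(outsideEdges G h) * rcWeight (finsetGraph G Λ) p q (wiredBoundary G Λ) ξ := by
  rw [rcWeight, rcWeight, card_openExtensionFin, card_edgeFinset_sdiff_openExtensionFin,
    coe_openExtensionFin, clusterCount_openExtension h hW hW', pow_add]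
  ring

/-- The key sum identity: summing the weights of `Δ` over the configurations that contain
`E_Δ ∖ E_Λ` and whose restriction lies in `B` gives `p^{|E_Δ ∖ E_Λ|}` times the sum of the
weights of `Λ` over `B`. [cite: Grimmett2006, Lemma (4.13) and proof of Thm. (4.19)(a)] -/
theorem sum_rcWeight_restrict_inter_outerOpen
    (hW : ∀ u ∈ envSet G Λ Δ, ∀ v ∈ envSet G Λ Δ, (envGraph G h).Reachable u v)
    (hW' : (∃ v : Δ, v.1 ∉ Λ) → (innerBoundary G Λ).Nonempty) (p q : ℝ)
    (A : Set (Percolation.BondConfig Δ)) [DecidablePred (· ∈ A)]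
    (B : Set (Percolation.BondConfig Λ)) [DecidablePred (· ∈ B)]
    (hAB : ∀ ω : Percolation.BondConfig Δ, ω ∈ A ↔ finsetRestrict h ω ∈ B ∧ (↑(outsideEdges G h) : Set (Sym2 Δ)) ⊆ ω) :
    ∑ ω ∈ (finsetGraph G Δ).edgeFinset.powerset,
        (if (↑ω : Percolation.BondConfig Δ) ∈ A then rcWeight (finsetGraph G Δ) p q (wiredBoundary G Δ) ω else 0) =
      p ^ #(outsideEdges G h) *
        ∑ ξ ∈ (finsetGraph G Λ).edgeFinset.powerset,
          (if (↑ξ : Percolation.BondConfig Λ) ∈ B then rcWeight (finsetGraph G Λ) p q (wiredBoundary G Λ) ξ else 0) := by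
  -- restrict the outer sum to the configurations containing the outer edges
  have step1 : ∑ ω ∈ (finsetGraph G Δ).edgeFinset.powerset,
      (if (↑ω : Percolation.BondConfig Δ) ∈ A then rcWeight (finsetGraph G Δ) p q (wiredBoundary G Δ) ω else 0) =
      ∑ ω ∈ (finsetGraph G Δ).edgeFinset.powerset.filter (fun ω => outsideEdges G h ⊆ ω),
        (if finsetRestrict h (↑ω : Percolation.BondConfig Δ) ∈ B
          then rcWeight (finsetGraph G Δ) p q (wiredBoundary G Δ) ω else 0) := by
    rw [Finset.sum_filter]
    refine Finset.sum_congr rfl fun ω _ => ?_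
    by_cases hout : outsideEdges G h ⊆ ω
    · rw [if_pos hout]
      refine if_congr ?_ rfl rfl
      rw [hAB]
      exact ⟨fun h' => h'.1, fun h' => ⟨h', Finset.coe_subset.2 hout⟩⟩
    · rw [if_neg hout, if_neg]
      rw [hAB]
      exact fun h' => hout (Finset.coe_subset.1 h'.2)
  rw [step1, filter_outsideEdges_subset_eq_map h, Finset.sum_map, Finset.mul_sum]
  refine Finset.sum_congr rfl fun ξ _ => ?_
  simp only [Function.Embedding.coeFn_mk, finsetRestrict_openExtension, rcWeight_openExtensionFin h hW hW']
  split_ifs <;> ring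

/-- A random-cluster probability as one quotient of sums of weights. [cite: Grimmett2006, §1.2, eq. (1.2)] -/
theorem rcMeasure_real_eq_sum_div {W : Type*} [Fintype W] [DecidableEq W] (H : SimpleGraph W)
    [DecidableRel H.Adj] {p q : ℝ} (hp : p ∈ Set.Icc (0 : ℝ) 1) (hq : 0 < q) (B : Set W)
    (A : Set (Percolation.BondConfig W)) [DecidablePred (· ∈ A)] :
    (rcMeasure H p q B).real A =
      (∑ ω ∈ H.edgeFinset.powerset, if (↑ω : Percolation.BondConfig W) ∈ A then rcWeight H p q B ω else 0) /
        rcPartitionFunction H p q B := by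
  rw [rcMeasure_real_apply H hp hq B A, Finset.sum_div]
  exact Finset.sum_congr rfl fun ω _ => by split_ifs <;> simp

/-- **Wired domain Markov property** (Grimmett 2006, Lemma (4.13) with `ξ = 1`, via Thm. (3.1)(a);
the first step of the proof of Thm. (4.19)(a) for `b = 1`): for finite vertex sets `Λ ⊆ Δ` of a
locally finite graph such that the environment `(Δ ∖ Λ) ∪ ∂Λ` is connected through
`E_Δ ∖ E_Λ` and the wiring of `∂Δ` (and `∂Λ ≠ ∅` unless `Δ ∖ Λ = ∅`), the wired measure of `Δ`
conditioned on "all edges of `E_Δ ∖ E_Λ` are open" is, on `E_Λ`, the wired measure of `Λ`: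
`φ¹_Δ(ρ⁻¹(B) ∩ {E_Δ∖E_Λ open}) = φ¹_Δ(E_Δ∖E_Λ open) · φ¹_Λ(B)` for every event `B` of `E_Λ`
(`ρ` = restriction), `0 ≤ p ≤ 1`, `q > 0`. [cite: Grimmett2006, Lemma (4.13) and proof of Thm. (4.19)(a)] -/
theorem rcMeasure_real_restrict_inter_outerOpen {p q : ℝ} (hp : p ∈ Set.Icc (0 : ℝ) 1) (hq : 0 < q)
    (hW : ∀ u ∈ envSet G Λ Δ, ∀ v ∈ envSet G Λ Δ, (envGraph G h).Reachable u v)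
    (hW' : (∃ v : Δ, v.1 ∉ Λ) → (innerBoundary G Λ).Nonempty) (B : Set (Percolation.BondConfig Λ)) :
    (rcMeasure (finsetGraph G Δ) p q (wiredBoundary G Δ)).real
        (finsetRestrict h ⁻¹' B ∩ {ω | (↑(outsideEdges G h) : Set (Sym2 Δ)) ⊆ ω}) =
      (rcMeasure (finsetGraph G Δ) p q (wiredBoundary G Δ)).real
          {ω | (↑(outsideEdges G h) : Set (Sym2 Δ)) ⊆ ω} *
        (rcMeasure (finsetGraph G Λ) p q (wiredBoundary G Λ)).real B := by
  classical
  have hZΔ := rcPartitionFunction_pos (finsetGraph G Δ) hp hq (wiredBoundary G Δ)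
  have hZΛ := rcPartitionFunction_pos (finsetGraph G Λ) hp hq (wiredBoundary G Λ)
  set U : Set (Percolation.BondConfig Δ) := {ω | (↑(outsideEdges G h) : Set (Sym2 Δ)) ⊆ ω} with hUdef
  have s1 := sum_rcWeight_restrict_inter_outerOpen h hW hW' p q (finsetRestrict h ⁻¹' B ∩ U) B
    (fun ω => Iff.rfl)
  have s2 := sum_rcWeight_restrict_inter_outerOpen h hW hW' p q U Set.univ
    (fun ω => by simp only [Set.mem_univ, true_and]; rfl)
  have hZ : ∑ ξ ∈ (finsetGraph G Λ).edgeFinset.powerset,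
      (if (↑ξ : Percolation.BondConfig Λ) ∈ (Set.univ : Set (Percolation.BondConfig Λ))
        then rcWeight (finsetGraph G Λ) p q (wiredBoundary G Λ) ξ else 0) =
      rcPartitionFunction (finsetGraph G Λ) p q (wiredBoundary G Λ) := by
    rw [rcPartitionFunction]
    exact Finset.sum_congr rfl fun ξ _ => if_pos (Set.mem_univ _)
  rw [hZ] at s2
  rw [rcMeasure_real_eq_sum_div _ hp hq, rcMeasure_real_eq_sum_div _ hp hq,
    rcMeasure_real_eq_sum_div _ hp hq, s1, s2]
  field_simp

/-- The event "all edges of `E_Δ ∖ E_Λ` are open" has positive probability for `p > 0` (the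
all-open configuration alone has positive weight). [folklore] -/
theorem rcMeasure_real_outerOpen_pos {p q : ℝ} (hp : p ∈ Set.Ioc (0 : ℝ) 1) (hq : 0 < q) :
    0 < (rcMeasure (finsetGraph G Δ) p q (wiredBoundary G Δ)).real
      {ω | (↑(outsideEdges G h) : Set (Sym2 Δ)) ⊆ ω} := by
  classical
  have hp' : p ∈ Set.Icc (0 : ℝ) 1 := ⟨hp.1.le, hp.2⟩
  have hZ := rcPartitionFunction_pos (finsetGraph G Δ) hp' hq (wiredBoundary G Δ)
  rw [rcMeasure_real_apply (finsetGraph G Δ) hp' hq]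
  refine lt_of_lt_of_le ?_ (Finset.single_le_sum (fun ω _ => ?_) (Finset.mem_powerset_self _))
  · rw [if_pos (by exact Finset.coe_subset.2 (outsideEdges_subset_edgeFinset h))]
    refine div_pos ?_ hZ
    simp only [rcWeight, Finset.sdiff_self, Finset.card_empty, pow_zero, mul_one]
    exact mul_pos (pow_pos hp.1 _) (pow_pos hq _)
  · split_ifs
    · exact div_nonneg (rcWeight_nonneg _ hp' hq.le _ _) hZ.le
    · exact le_rfl

/-- **Monotonicity in the domain for the wired measure** (Grimmett 2006, proof of Thm. (4.19)(a),
eq. (4.24) with the inequality reversed for `b = 1`): under the hypotheses of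
`rcMeasure_real_restrict_inter_outerOpen`, for `0 ≤ p ≤ 1`, `q ≥ 1` and every increasing event
`B` of `E_Λ`, `φ¹_{Δ,p,q}(B) ≤ φ¹_{Λ,p,q}(B)` (with `B` read on `E_Δ` through the restriction):
the wired measures decrease as the domain grows. From the domain Markov property and positive
association (FKG): `φ¹_Δ(B) φ¹_Δ(U) ≤ φ¹_Δ(B ∩ U) = φ¹_Δ(U) φ¹_Λ(B)`, `U = {E_Δ∖E_Λ open}`
increasing (for `p > 0`; at `p = 0` both measures are the point mass at `∅`).
[cite: Grimmett2006, Thm. (4.19)(a), proof, eq. (4.24)] -/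
theorem rcMeasure_real_restrict_le {p q : ℝ} (hp : p ∈ Set.Icc (0 : ℝ) 1) (hq : 1 ≤ q)
    (hW : ∀ u ∈ envSet G Λ Δ, ∀ v ∈ envSet G Λ Δ, (envGraph G h).Reachable u v)
    (hW' : (∃ v : Δ, v.1 ∉ Λ) → (innerBoundary G Λ).Nonempty)
    {B : Set (Percolation.BondConfig Λ)} (hB : IsUpperSet B) :
    (rcMeasure (finsetGraph G Δ) p q (wiredBoundary G Δ)).real (finsetRestrict h ⁻¹' B) ≤
      (rcMeasure (finsetGraph G Λ) p q (wiredBoundary G Λ)).real B := by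
  have hq0 : 0 < q := one_pos.trans_le hq
  rcases hp.1.eq_or_lt with hp0 | hp0
  · -- `p = 0`: both measures are the point mass at the empty configuration
    subst hp0
    classical
    haveI := isProbabilityMeasure_rcMeasure (finsetGraph G Δ) hp hq0 (wiredBoundary G Δ)
    haveI := isProbabilityMeasure_rcMeasure (finsetGraph G Λ) hp hq0 (wiredBoundary G Λ)
    by_cases hB0 : (∅ : Percolation.BondConfig Λ) ∈ B
    · have hBu : B = Set.univ := Set.eq_univ_of_forall fun ω => hB (Set.empty_subset ω) hB0
      rw [hBu, probReal_univ]
      exact measureReal_le_one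
    · have h0 : (rcMeasure (finsetGraph G Δ) 0 q (wiredBoundary G Δ)).real (finsetRestrict h ⁻¹' B) = 0 := by
        rw [rcMeasure_real_apply (finsetGraph G Δ) hp hq0]
        refine Finset.sum_eq_zero fun ω _ => ?_
        rcases ω.eq_empty_or_nonempty with rfl | hne
        · rw [if_neg]
          rw [Set.mem_preimage, Finset.coe_empty]
          intro hmem
          rw [finsetRestrict_empty] at hmem
          exact hB0 hmem
        · simp [rcWeight, zero_pow (Finset.card_ne_zero.2 hne)]
      rw [h0]
      exact measureReal_nonneg
  · have hU : IsUpperSet {ω : Percolation.BondConfig Δ | (↑(outsideEdges G h) : Set (Sym2 Δ)) ⊆ ω} :=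
      fun _ _ hω hsub => hsub.trans hω
    have hB' : IsUpperSet (finsetRestrict h ⁻¹' B) := fun _ _ hω hmem => hB (finsetRestrict_mono h hω) hmem
    have hfkg := rcMeasure_fkg_holds (finsetGraph G Δ) hp hq (wiredBoundary G Δ) hB' hU
    rw [rcMeasure_real_restrict_inter_outerOpen h hp hq0 hW hW' B, mul_comm] at hfkg
    exact le_of_mul_le_mul_left hfkg (rcMeasure_real_outerOpen_pos h ⟨hp0, hp.2⟩ hq0)

end Measure

/-! ### Two general-purpose lemmas: support of the measure; open paths to the boundary restrict -/

section Support

variable {W : Type*} [Fintype W] [DecidableEq W] (H : SimpleGraph W) [DecidableRel H.Adj]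

/-- The random-cluster measure lives on the edge sets of the graph: if `A ⊆ A'` on configurations
`ω ⊆ E(H)`, then `φ(A) ≤ φ(A')`. [cite: Grimmett2006, §1.2, eq. (1.2)] -/
theorem rcMeasure_real_mono_on_edgeSets {p q : ℝ} (hp : p ∈ Set.Icc (0 : ℝ) 1) (hq : 0 < q)
    (B : Set W) {A A' : Set (Percolation.BondConfig W)}
    (hAA' : ∀ ω : Percolation.BondConfig W, ω ⊆ H.edgeSet → ω ∈ A → ω ∈ A') :
    (rcMeasure H p q B).real A ≤ (rcMeasure H p q B).real A' := by
  classical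
  have hZ := rcPartitionFunction_pos H hp hq B
  rw [rcMeasure_real_apply H hp hq B A, rcMeasure_real_apply H hp hq B A']
  refine Finset.sum_le_sum fun ω hω => ?_
  have hωE : (↑ω : Percolation.BondConfig W) ⊆ H.edgeSet := by
    rw [← coe_edgeFinset]; exact Finset.coe_subset.2 (Finset.mem_powerset.1 hω)
  have h0 : 0 ≤ rcWeight H p q B ω / rcPartitionFunction H p q B :=
    div_nonneg (rcWeight_nonneg H hp hq.le B ω) hZ.le
  by_cases hA : (↑ω : Percolation.BondConfig W) ∈ A
  · rw [if_pos hA, if_pos (hAA' _ hωE hA)]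
  · rw [if_neg hA]; split_ifs <;> [exact h0; exact le_rfl]

end Support

section BoundaryPath

variable [DecidableEq V] {G : SimpleGraph V} [G.LocallyFinite] {Λ Δ : Finset V} (h : Λ ⊆ Δ)

omit [DecidableEq V] in
/-- The open graph of the restricted configuration is the pull-back of the open graph along the
inclusion. [folklore] -/
theorem openGraph_finsetRestrict_adj (ω : Percolation.BondConfig Δ) (a b : Λ) :
    (Percolation.openGraph (finsetRestrict h ω)).Adj a b ↔
      (Percolation.openGraph ω).Adj (finsetIncl h a) (finsetIncl h b) := by
  rw [Percolation.openGraph, Percolation.openGraph, fromEdgeSet_adj, fromEdgeSet_adj,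
    mem_finsetRestrict_iff, edgeLift_mk, (finsetIncl_injective h).ne_iff]

/-- **Open paths to the outer boundary pass the inner boundary.** Let `Λ ⊆ Δ` and let `ω ⊆ E_Δ`
be a configuration of `Δ`. If a vertex `x ∈ Λ` is joined by an `ω`-open path to a vertex of
`∂Δ`, then `x` is joined to a vertex of `∂Λ` by a path that is open in the restriction of `ω` to
`E_Λ` (follow the path until it first leaves `Λ`, or to its end). [cite: Grimmett2006, Prop. (5.11) (proof)] -/
theorem exists_reachable_wiredBoundary_restrict {ω : Percolation.BondConfig Δ}
    (hω : ω ⊆ (finsetGraph G Δ).edgeSet) {x : Λ} {y : Δ} (hy : y ∈ wiredBoundary G Δ)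
    (hxy : (Percolation.openGraph ω).Reachable (finsetIncl h x) y) :
    ∃ z : Λ, z ∈ wiredBoundary G Λ ∧ (Percolation.openGraph (finsetRestrict h ω)).Reachable x z := by
  by_contra hno'
  have hno : ∀ a : Λ, a.1 ∈ innerBoundary G Λ →
      ¬(Percolation.openGraph (finsetRestrict h ω)).Reachable x a :=
    fun a hb ha => hno' ⟨a, hb, ha⟩
  -- `P v`: `v` is the image of a vertex of `Λ` joined to `x` in the restriction
  set P : Δ → Prop := fun v => ∃ a : Λ, finsetIncl h a = v ∧
    (Percolation.openGraph (finsetRestrict h ω)).Reachable x a with hP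
  have hstep : ∀ u v : Δ, P u → (Percolation.openGraph ω).Adj u v → P v := by
    rintro u v ⟨a, rfl, ha⟩ huv
    -- `a` is not on `∂Λ`, so its neighbour `v` lies in `Λ`
    have hadj : G.Adj a.1 v.1 := by
      have := hω ((Percolation.openGraph_adj ω _ _).1 huv).1
      exact this
    have hvΛ : v.1 ∈ Λ := by
      by_contra hv
      exact hno a (mem_innerBoundary_iff.2 ⟨a.2, v.1, hv, hadj⟩) ha
    refine ⟨⟨v.1, hvΛ⟩, rfl, ha.trans (Adj.reachable ?_)⟩
    rw [openGraph_finsetRestrict_adj]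
    exact huv
  have hPy : P y := by
    obtain ⟨w⟩ := hxy
    -- walk induction from `finsetIncl h x`
    suffices ∀ u : Δ, P u → ∀ v : Δ, (Percolation.openGraph ω).Walk u v → P v from
      this _ ⟨x, rfl, Reachable.refl _⟩ _ w
    intro u hu v w'
    induction w' with
    | nil => exact hu
    | cons hadj _ ih => exact ih (hstep _ _ hu hadj)
  obtain ⟨a, hay, ha⟩ := hPy
  -- `y ∈ ∂Δ` and `y = a ∈ Λ` force `a ∈ ∂Λ`
  rw [mem_wiredBoundary_iff, mem_innerBoundary_iff] at hy
  obtain ⟨_, z, hz, hyz⟩ := hy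
  refine hno a (mem_innerBoundary_iff.2 ⟨a.2, z, fun hzΛ => hz (h hzΛ), ?_⟩) ha
  rw [← hay] at hyz
  exact hyz

end BoundaryPath

/-! ### Boxes of `ℤ^d`: the environment of `Λ_m ⊆ Λ_n` is connected, so all of the above applies -/

section Zd

variable {d : ℕ}

/-- A lifted edge has both endpoints in `Λ`; an edge with an endpoint outside `Λ` is not inner.
[folklore] -/
theorem notMem_insideEdges_of_notMem {G : SimpleGraph V} [DecidableRel G.Adj] {Λ Δ : Finset V}
    (h : Λ ⊆ Δ) {u v : Δ} (hv : v.1 ∉ Λ) : s(u, v) ∉ insideEdges G h := by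
  intro he
  obtain ⟨e, _, heq⟩ := Finset.mem_map.1 he
  induction e using Sym2.ind with
  | h a b =>
    rw [edgeLift_mk, Sym2.eq_iff] at heq
    rcases heq with ⟨_, rfl⟩ | ⟨rfl, _⟩
    · exact hv b.2
    · exact hv a.2

/-- An edge of `Δ` with an endpoint outside `Λ` is an edge of the environment graph. [folklore] -/
theorem envGraph_adj_of_adj_of_notMem [DecidableEq V] {G : SimpleGraph V} [DecidableRel G.Adj]
    [G.LocallyFinite] {Λ Δ : Finset V} (h : Λ ⊆ Δ) {u v : Δ} (hadj : G.Adj u.1 v.1) (hv : v.1 ∉ Λ) :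
    (envGraph G h).Adj u v := by
  rw [envGraph, sup_adj, fromEdgeSet_adj, Finset.mem_coe, outsideEdges, Finset.mem_sdiff, mem_edgeFinset,
    mem_edgeSet]
  exact Or.inl ⟨⟨hadj, notMem_insideEdges_of_notMem h hv⟩, fun huv => hadj.ne (congrArg Subtype.val huv)⟩

/-- Two vertices of `∂Δ` are joined in the environment graph (they are wired). [folklore] -/
theorem envGraph_reachable_of_mem_wiredBoundary [DecidableEq V] {G : SimpleGraph V} [DecidableRel G.Adj]
    [G.LocallyFinite] {Λ Δ : Finset V} (h : Λ ⊆ Δ) {u v : Δ} (hu : u ∈ wiredBoundary G Δ)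
    (hv : v ∈ wiredBoundary G Δ) : (envGraph G h).Reachable u v := by
  by_cases huv : u = v
  · rw [huv]
  · refine Adj.reachable ?_
    rw [envGraph, sup_adj, wired_adj]
    exact Or.inr ⟨huv, hu, hv⟩

/-- `x - eᵢ` is a neighbour of `x` in `ℤ^d`. [folklore] -/
theorem zdGraph_adj_sub_single_one (x : Site d) (i : Fin d) : (zdGraph d).Adj x (x - Pi.single i 1) :=
  (zdGraph_adj_iff _ _).2 ⟨i, Or.inr (by rw [sub_add_cancel])⟩

/-- `x - eᵢ = x + (-1) eᵢ`. [folklore] -/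
theorem sub_single_eq (x : Site d) (i : Fin d) : x - Pi.single i (1 : ℤ) = x + Pi.single i (-1) := by
  rw [sub_eq_add_neg, ← Pi.single_neg]

/-- A vertex of `Λ_n` whose `i`-th coordinate is `n` lies on `∂Λ_n`. [cite: Grimmett2006, §4.2 (∂Λ)] -/
theorem mem_innerBoundary_box_of_apply_eq {n : ℕ} {x : Site d} (hx : x ∈ box d n) (i : Fin d)
    (hi : x i = n) : x ∈ innerBoundary (zdGraph d) (box d n) := by
  refine mem_innerBoundary_iff.2 ⟨hx, x + Pi.single i 1, fun hmem => ?_, (zdGraph_adj_iff _ _).2 ⟨i, Or.inl rfl⟩⟩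
  have := ((mem_box.1 hmem) i).2
  rw [Pi.add_apply, Pi.single_eq_same] at this
  omega

/-- A vertex of `Λ_n` whose `i`-th coordinate is `-n` lies on `∂Λ_n`. [cite: Grimmett2006, §4.2 (∂Λ)] -/
theorem mem_innerBoundary_box_of_apply_eq_neg {n : ℕ} {x : Site d} (hx : x ∈ box d n) (i : Fin d)
    (hi : x i = -n) : x ∈ innerBoundary (zdGraph d) (box d n) := by
  refine mem_innerBoundary_iff.2 ⟨hx, x - Pi.single i 1, fun hmem => ?_, zdGraph_adj_sub_single_one x i⟩
  have := ((mem_box.1 hmem) i).1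
  rw [sub_single_eq, Pi.add_apply, Pi.single_eq_same] at this
  omega

/-- `∂Λ_m ≠ ∅` in dimension `d ≥ 1`: the vertex `m e₀` is on it. [cite: Grimmett2006, §4.2 (∂Λ)] -/
theorem innerBoundary_box_nonempty (hd : 0 < d) (m : ℕ) :
    (innerBoundary (zdGraph d) (box d m)).Nonempty := by
  refine ⟨Pi.single ⟨0, hd⟩ (m : ℤ), mem_innerBoundary_box_of_apply_eq ?_ ⟨0, hd⟩ (by simp)⟩
  rw [mem_box]
  intro j
  rw [Pi.single_apply]
  split_ifs <;> omega

/-- Moving one step in direction `+eᵢ` inside `Λ_n` (possible while the `i`-th coordinate is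
`< n`) stays in `Λ_n`. [folklore] -/
theorem add_single_mem_box {n : ℕ} {x : Site d} (hx : x ∈ box d n) {i : Fin d} (hi : x i < n) :
    x + Pi.single i 1 ∈ box d n := by
  rw [mem_box] at hx ⊢
  intro j
  by_cases hji : j = i
  · subst hji; rw [Pi.add_apply, Pi.single_eq_same]; have := hx j; omega
  · rw [Pi.add_apply, Pi.single_eq_of_ne hji, add_zero]; exact hx j

/-- Moving one step in direction `-eᵢ` inside `Λ_n` (possible while the `i`-th coordinate is
`> -n`) stays in `Λ_n`. [folklore] -/
theorem sub_single_mem_box {n : ℕ} {x : Site d} (hx : x ∈ box d n) {i : Fin d} (hi : -(n : ℤ) < x i) :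
    x - Pi.single i 1 ∈ box d n := by
  rw [sub_single_eq]
  rw [mem_box] at hx ⊢
  intro j
  by_cases hji : j = i
  · subst hji; rw [Pi.add_apply, Pi.single_eq_same]; have := hx j; omega
  · rw [Pi.add_apply, Pi.single_eq_of_ne hji, add_zero]; exact hx j

/-- **Outward escape, increasing coordinate.** In `Λ_n`, a vertex with `i`-th coordinate `> m` is
joined in the environment graph of `Λ_m ⊆ Λ_n` to a vertex of `∂Λ_n` (move in direction `+eᵢ`).
[folklore] -/
theorem box_envGraph_reachable_boundary_of_lt {m n : ℕ} (hmn : m ≤ n) (i : Fin d) :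
    ∀ k : ℕ, ∀ v : ↥(box d n), (m : ℤ) < v.1 i → (n : ℤ) - v.1 i ≤ k →
      ∃ t : ↥(box d n), t ∈ wiredBoundary (zdGraph d) (box d n) ∧
        (envGraph (zdGraph d) (box_mono d hmn)).Reachable v t := by
  intro k
  induction k with
  | zero =>
    intro v _ hk
    have hvn : v.1 i = n := le_antisymm ((mem_box.1 v.2) i).2 (by omega)
    exact ⟨v, mem_innerBoundary_box_of_apply_eq v.2 i hvn, Reachable.refl _⟩
  | succ k ih =>
    intro v hvm hk
    by_cases hvn : v.1 i = n
    · exact ⟨v, mem_innerBoundary_box_of_apply_eq v.2 i hvn, Reachable.refl _⟩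
    · have hlt : v.1 i < n := lt_of_le_of_ne ((mem_box.1 v.2) i).2 hvn
      have hw : v.1 + Pi.single i 1 ∈ box d n := add_single_mem_box v.2 hlt
      have hwm : v.1 + Pi.single i 1 ∉ box d m := by
        intro hmem
        have := ((mem_box.1 hmem) i).2
        rw [Pi.add_apply, Pi.single_eq_same] at this
        omega
      have hwi : (v.1 + Pi.single i 1 : Site d) i = v.1 i + 1 := by rw [Pi.add_apply, Pi.single_eq_same]
      obtain ⟨t, ht, hwt⟩ := ih ⟨v.1 + Pi.single i 1, hw⟩ (by dsimp only; rw [hwi]; omega)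
        (by dsimp only; rw [hwi]; omega)
      exact ⟨t, ht, (Adj.reachable (envGraph_adj_of_adj_of_notMem (box_mono d hmn)
        (v := ⟨v.1 + Pi.single i 1, hw⟩) ((zdGraph_adj_iff _ _).2 ⟨i, Or.inl rfl⟩) hwm)).trans hwt⟩

/-- **Outward escape, decreasing coordinate.** In `Λ_n`, a vertex with `i`-th coordinate `< -m`
is joined in the environment graph of `Λ_m ⊆ Λ_n` to a vertex of `∂Λ_n` (move in direction
`-eᵢ`). [folklore] -/
theorem box_envGraph_reachable_boundary_of_lt_neg {m n : ℕ} (hmn : m ≤ n) (i : Fin d) :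
    ∀ k : ℕ, ∀ v : ↥(box d n), v.1 i < -(m : ℤ) → (n : ℤ) + v.1 i ≤ k →
      ∃ t : ↥(box d n), t ∈ wiredBoundary (zdGraph d) (box d n) ∧
        (envGraph (zdGraph d) (box_mono d hmn)).Reachable v t := by
  intro k
  induction k with
  | zero =>
    intro v _ hk
    have hvn : v.1 i = -n := le_antisymm (by omega) ((mem_box.1 v.2) i).1
    exact ⟨v, mem_innerBoundary_box_of_apply_eq_neg v.2 i hvn, Reachable.refl _⟩
  | succ k ih =>
    intro v hvm hk
    by_cases hvn : v.1 i = -n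
    · exact ⟨v, mem_innerBoundary_box_of_apply_eq_neg v.2 i hvn, Reachable.refl _⟩
    · have hlt : -(n : ℤ) < v.1 i := lt_of_le_of_ne ((mem_box.1 v.2) i).1 (Ne.symm hvn)
      have hw : v.1 - Pi.single i 1 ∈ box d n := sub_single_mem_box v.2 hlt
      have hwi : (v.1 - Pi.single i 1 : Site d) i = v.1 i - 1 := by
        rw [sub_single_eq, Pi.add_apply, Pi.single_eq_same]; ring
      have hwm : v.1 - Pi.single i 1 ∉ box d m := by
        intro hmem
        have := ((mem_box.1 hmem) i).1
        rw [hwi] at this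
        omega
      obtain ⟨t, ht, hwt⟩ := ih ⟨v.1 - Pi.single i 1, hw⟩ (by dsimp only; rw [hwi]; omega)
        (by dsimp only; rw [hwi]; omega)
      exact ⟨t, ht, (Adj.reachable (envGraph_adj_of_adj_of_notMem (box_mono d hmn)
        (v := ⟨v.1 - Pi.single i 1, hw⟩) (zdGraph_adj_sub_single_one v.1 i) hwm)).trans hwt⟩

/-- Every vertex of `Λ_n` outside `Λ_m` is joined in the environment graph to `∂Λ_n`.
[folklore] -/
theorem box_envGraph_reachable_boundary_of_notMem {m n : ℕ} (hmn : m ≤ n) (v : ↥(box d n))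
    (hv : v.1 ∉ box d m) :
    ∃ t : ↥(box d n), t ∈ wiredBoundary (zdGraph d) (box d n) ∧
      (envGraph (zdGraph d) (box_mono d hmn)).Reachable v t := by
  rw [mem_box, not_forall] at hv
  obtain ⟨i, hi⟩ := hv
  rcases not_and_or.1 hi with hi | hi
  · exact box_envGraph_reachable_boundary_of_lt_neg hmn i ((n : ℤ) + v.1 i).toNat v (by omega)
      (Int.self_le_toNat _)
  · exact box_envGraph_reachable_boundary_of_lt hmn i ((n : ℤ) - v.1 i).toNat v (by omega)
      (Int.self_le_toNat _)

/-- Every environment vertex of `Λ_m ⊆ Λ_n` (outside `Λ_m`, or on `∂Λ_m`) is joined in the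
environment graph to `∂Λ_n`. [folklore] -/
theorem box_envGraph_reachable_boundary_of_mem_envSet {m n : ℕ} (hmn : m ≤ n) (v : ↥(box d n))
    (hv : v ∈ envSet (zdGraph d) (box d m) (box d n)) :
    ∃ t : ↥(box d n), t ∈ wiredBoundary (zdGraph d) (box d n) ∧
      (envGraph (zdGraph d) (box_mono d hmn)).Reachable v t := by
  by_cases hvm : v.1 ∈ box d m
  · have hvb : v.1 ∈ innerBoundary (zdGraph d) (box d m) := hv.resolve_left (fun hn => hn hvm)
    obtain ⟨_, y, hy, hvy⟩ := mem_innerBoundary_iff.1 hvb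
    by_cases hyn : y ∈ box d n
    · set w : ↥(box d n) := ⟨y, hyn⟩
      obtain ⟨t, ht, hwt⟩ := box_envGraph_reachable_boundary_of_notMem hmn w hy
      exact ⟨t, ht, (Adj.reachable (envGraph_adj_of_adj_of_notMem (box_mono d hmn) (v := w) hvy hy)).trans hwt⟩
    · exact ⟨v, mem_innerBoundary_iff.2 ⟨v.2, y, hyn, hvy⟩, Reachable.refl _⟩
  · exact box_envGraph_reachable_boundary_of_notMem hmn v hvm

/-- **The environment of `Λ_m ⊆ Λ_n` is connected**: any two environment vertices are joined in
the environment graph (through `∂Λ_n`, which is wired). [folklore] -/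
theorem box_envSet_connected {m n : ℕ} (hmn : m ≤ n) :
    ∀ u ∈ envSet (zdGraph d) (box d m) (box d n), ∀ v ∈ envSet (zdGraph d) (box d m) (box d n),
      (envGraph (zdGraph d) (box_mono d hmn)).Reachable u v := by
  intro u hu v hv
  obtain ⟨tu, htu, hutu⟩ := box_envGraph_reachable_boundary_of_mem_envSet hmn u hu
  obtain ⟨tv, htv, hvtv⟩ := box_envGraph_reachable_boundary_of_mem_envSet hmn v hv
  exact hutu.trans ((envGraph_reachable_of_mem_wiredBoundary _ htu htv).trans hvtv.symm)

/-- **Monotonicity of the wired box measures in the box** (Grimmett 2006, proof of Thm. (4.19)(a),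
(4.24) reversed, for the boxes `Λ_m ⊆ Λ_n` of `ℤ^d`, `d ≥ 1`): for `0 ≤ p ≤ 1`, `q ≥ 1` and an
increasing event `B` of `E_{Λ_m}`, `φ¹_{Λ_n,p,q}(B) ≤ φ¹_{Λ_m,p,q}(B)`.
[cite: Grimmett2006, Thm. (4.19)(a), proof, eq. (4.24)] -/
theorem rcMeasure_real_box_restrict_le (hd : 0 < d) {m n : ℕ} (hmn : m ≤ n) {p q : ℝ}
    (hp : p ∈ Set.Icc (0 : ℝ) 1) (hq : 1 ≤ q) {B : Set (Percolation.BondConfig ↥(box d m))}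
    (hB : IsUpperSet B) :
    (rcMeasure (finsetGraph (zdGraph d) (box d n)) p q (wiredBoundary (zdGraph d) (box d n))).real
        (finsetRestrict (box_mono d hmn) ⁻¹' B) ≤
      (rcMeasure (finsetGraph (zdGraph d) (box d m)) p q (wiredBoundary (zdGraph d) (box d m))).real B :=
  rcMeasure_real_restrict_le (box_mono d hmn) hp hq (box_envSet_connected hmn)
    (fun _ => innerBoundary_box_nonempty hd m) hB

/-- The wired domain Markov property for boxes (Grimmett 2006, Lemma (4.13), `ξ = 1`):
`φ¹_{Λ_n}(ρ⁻¹(B) ∩ {E_{Λ_n}∖E_{Λ_m} open}) = φ¹_{Λ_n}(E_{Λ_n}∖E_{Λ_m} open) φ¹_{Λ_m}(B)` for every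
event `B` of `E_{Λ_m}`, `m ≤ n`, `d ≥ 1`, `0 ≤ p ≤ 1`, `q > 0`. [cite: Grimmett2006, Lemma (4.13)] -/
theorem rcMeasure_real_box_restrict_inter_outerOpen (hd : 0 < d) {m n : ℕ} (hmn : m ≤ n) {p q : ℝ}
    (hp : p ∈ Set.Icc (0 : ℝ) 1) (hq : 0 < q) (B : Set (Percolation.BondConfig ↥(box d m))) :
    (rcMeasure (finsetGraph (zdGraph d) (box d n)) p q (wiredBoundary (zdGraph d) (box d n))).real
        (finsetRestrict (box_mono d hmn) ⁻¹' B ∩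
          {ω | (↑(outsideEdges (zdGraph d) (box_mono d hmn)) : Set (Sym2 ↥(box d n))) ⊆ ω}) =
      (rcMeasure (finsetGraph (zdGraph d) (box d n)) p q (wiredBoundary (zdGraph d) (box d n))).real
          {ω | (↑(outsideEdges (zdGraph d) (box_mono d hmn)) : Set (Sym2 ↥(box d n))) ⊆ ω} *
        (rcMeasure (finsetGraph (zdGraph d) (box d m)) p q (wiredBoundary (zdGraph d) (box d m))).real B :=
  rcMeasure_real_restrict_inter_outerOpen (box_mono d hmn) hp hq (box_envSet_connected hmn)
    (fun _ => innerBoundary_box_nonempty hd m) B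

end Zd

end Literature.Probability.LatticeModels

end
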